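/-
Literature/AlgebraicGeometry/Pohlmann1968/DegenerateCMTypesAbelianCMFieldRankFormula.lean — pub-hodgecm2 (COR-CM), KEPT Literature lane lit-deligne-3 gen 66,
file F66l.  THEOREMS ONLY (no `def`, no named fact, no `sorry`, no instance, no notation; D-0026 net debt 0).  HC_CM is NOT proved.
-/
import Literature.AlgebraicGeometry.Pohlmann1968.DegenerateCMTypesAbelianCMFieldExponentFourOdd
import Literature.NumberTheory.ComplexMultiplication.DegenerateCMTypesAbelianKernelsRankFormula
import HarnessLib

/-!
# THE RANK OF A CM TYPE OF ANY ABELIAN CM FIELD, ON THE LATTICE OF SUBFIELDS (`g^{2^{r+1}m} = 1` on `Gal(K/ℚ)`, `m` odd):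
# `Rank(Φ) + b + Σ_{j=2}^{r+1} 2^{j−1}·e_{2^j} + Σ_{j=1}^{r+1} Σ_{d ∣ m, d ≠ 1} φ(2^j d)·s_{2^j d} = [K:ℚ]/2 + 1`; the nondegeneracy criterion; the Hodge
# conjecture for all powers off the lists; `ℚ(ζ₄₁)`, `ℚ(ζ₇₃)`, `ℚ(ζ₁₁₉)`

Topic `Literature/AlgebraicGeometry/Pohlmann1968` (namespace `Literature.AlgebraicGeometry.Pohlmann1968.RankFormula`); cell `pub-hodgecm2` (COR-CM), KEPT Literature lane
`lit-deligne-3` gen 66, file F66l — the FIELD-LEVEL CAPSTONE of the lane's abelian programme: the group-level F66k (Kubota's defect of a CM type of ANY finite abelian group,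
every kernel class decided) transferred to abelian CM fields and read on the lattice of subfields by the lane's dictionaries (index `2`: Weil quadratic; index `2^j`,
cyclic: equidistribution over `F`, §1; index `2^j d`: F66a `card_index_isCyclic_eq_ncard_mixed`).  Every exponent-specific file of the lane (`2p, 4p, 2p², 4p², 2pq, 4pq,
2m, 4m` with `m` squarefree or odd) is a specialisation.  KERNEL ONLY: theorems; no `def`, no named fact, no instance, no notation (D-0014 ∕ D-0026 net debt `0`).
HC_CM is NOT proved here or anywhere in the lane.

## Mathematics

Let `K` be a CM field, abelian over `ℚ`, with `g^{2^{r+1}m} = 1` on `G = Gal(K/ℚ)` (`m` odd; always possible), `ρ` = complex conjugation, `Φ` a CM type.  Kubota's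
defect [Kubota1965, §4 Lemma 2] regrouped by kernels (White) runs over the subgroups `H ∌ ρ` with `G/H` cyclic whose characters all vanish on `S = {g : φ₀∘g⁻¹ ∈ Φ}`;
`[G:H] = 2^j d`, `1 ≤ j ≤ r+1`, `d ∣ m`, and through the Galois correspondence `H = Gal(K/F)`, `F` a CM subfield of degree `2^j d` with `Gal(F/ℚ)` cyclic
([Yanai2015IndexDegeneracy] Thm. 4.1, [MilneFT2022] Thm. 3.16).  The class conditions read on `F`: `j = 1, d = 1` — `Φ` of Weil type over the imaginary quadratic
`F` ([Dodson1984] §3.1.1); `j ≥ 2, d = 1` — every `τ : F → ℂ` has exactly `[K:F]/2` extensions in `Φ` ([Gordon1999HodgeAVSurvey] 9.4.3, Yanai); `d ≠ 1` — for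
every family `σ_q ∈ Gal(F/ℚ)` (`q ∣ d` prime) with `σ_q^q = 1` and every `τ`, `Σ_ε (−1)^{|ε|} #{φ ∈ Φ : φ|_F = τ ∘ Π_{ε_q=1} σ_q} = 0` ([Hazama2003CyclicCM] Lemma
4.6.1 with multiplicities, [LamLeung2000] Thm. 2.2, [Washington1997] Thm. 2.5; the lane's F66j).  Hence (**`cmTypeRank_add_ncard_subfields_eq`**)

  `Rank(Φ) + b(Φ) + Σ_{j=2}^{r+1} φ(2^j)·e_{2^j}(Φ) + Σ_{j=1}^{r+1} Σ_{d ∣ m, d ≠ 1} φ(2^j d)·s_{2^j d}(Φ) = [K:ℚ]/2 + 1`,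

NONDEGENERATE iff all the subfield sets are empty (**`isNondegenerate_iff_forall_intermediateField`**), and then `B•(Aⁿ) ⊗ ℂ = D•(Aⁿ) ⊗ ℂ` and the Hodge conjecture
hold for all powers of every abelian variety of type `(K; Φ)` (Pohlmann ∕ Hazama; tree `IsNondegenerate.hodgeClassSpan_pow_eq_divisorClassesSpan`).

* §1 the dictionary for the `2`-power classes at any index (`card_index_isCyclic_halving_eq_ncard`, `forall_subgroup_isCyclic_halving_iff_forall_intermediateField`;
  the index-`4` case is the tree's `card_indexFour_eq_ncard_weilQuartic`).
* §2 on `Gal(K/ℚ)`: `cmTypeRank_add_card_kernels_eq`; on subfields: **`cmTypeRank_add_ncard_subfields_eq`**, **`isNondegenerate_iff_forall_intermediateField`**;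
  §2b HYPOTHESIS-FREE forms with `2^{r+1}m := [K:ℚ]`: **`cmTypeRank_add_ncard_subfields_eq_finrank`**, **`isNondegenerate_iff_forall_intermediateField_finrank`**.
* §3 abelian varieties: `hodgeClassSpan_pow_eq_divisorClassesSpan_of_forall_intermediateField`, **`hodgeConjectureFor_pow_of_forall_intermediateField`**.
* §4 cyclotomic fields `ℚ(ζ_N)` with `u^{2^{r+1}m} = 1` on `(ℤ/N)ˣ`; the levels `41` (`ℤ/40 = ℤ/8·5`), `73` (`ℤ/72`, `72 = 2³·3²`, `φ = 72`), `119` (`ℤ/16 × ℤ/6`,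
  exponent `48 = 2⁴·3`, `φ = 96`) — `2`-exponents `8` and `16`, beyond every earlier file of the lane.

PRESEARCH (lane rule): as for F66f ∕ F66h ∕ F66k (corpus hybrid + vector «rank CM type abelian CM field subfields Weil type equidistributed», galaxy «degenerate CM
type | rank of a CM-type | index of degeneracy», all stars, lane queries gen 64–66): the complete subfield-lattice formula for an arbitrary abelian CM field is not
found as printed (the cyclic case is [Hazama2003CyclicCM] Thm. 4.8, the `2`-power case the tree's `AbelianTwoPower`); recorded as the lane's own elementary theorem
with the citations above.

HONEST REGISTER.  Unconditional given the tree; nothing is claimed about the Hodge classes of DEGENERATE types; the cyclotomic statements carry the true instance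
hypotheses `[IsCMField L] [IsAbelianGalois ℚ L]`.  HC_CM is NOT proved and not used.

## References

* [Kubota1965] T. Kubota, *On the field extension by complex multiplication*, Trans. AMS 118 (1965), §4 Lemma 2.
* [White1993SporadicCycles] S. P. White, *Sporadic cycles on CM abelian varieties*, Compositio Math. 88 (1993), §4, proof of Lemma 3 (p. 131).
* [Dodson1984] B. Dodson, *The structure of Galois groups of CM-fields*, Trans. AMS 283 (1984), §3.1.1 Theorem.
* [Yanai2015IndexDegeneracy] H. Yanai, *On degenerate CM-types*, J. Number Theory 152 (2015), Thm. 4.1 (proof, p. 818).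
* [MilneFT2022] J. S. Milne, *Fields and Galois Theory* (v5.10, 2022), Thm. 3.16.
* [Gordon1999HodgeAVSurvey] B. B. Gordon, *A survey of the Hodge conjecture for abelian varieties* (1999), Thm. 6.4, §9.3, 9.4.3.
* [Hazama2003CyclicCM] F. Hazama, J. Math. Sci. Univ. Tokyo 10 (2003): Prop. 4.3, Lemma 4.6.1, Thm. 4.8.
* [LamLeung2000] T. Y. Lam, K. H. Leung, *On vanishing sums of roots of unity*, J. Algebra 224 (2000), Thm. 2.2.
* [Washington1997] L. C. Washington, *Introduction to cyclotomic fields*, 2nd ed. (1997), Ch. 2: Prop. 2.4, Thm. 2.5.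

## Provenance

Cell `pub-hodgecm2` (COR-CM), KEPT Literature lane `lit-deligne-3` gen 66 (claim ABELIAN-RANK-FORMULA-FIELD; count-neutral, own lane), file F66l; neighbours cited by name,
nothing restated: `DegenerateCMTypesAbelianKernelsRankFormula` (F66k), `DegenerateCMTypesAbelianCMFieldExponentFourOdd` (F66h, cone), `…MixedDifferencesSubfields` (F66a),
`…CyclicSubfields` ∕ `…CyclicQuarticSubfields` (dictionaries), `ExponentFourTimesPrime.cm_abelian_pow_eq_one_of_isCyclotomicExtension`.  Theorems only; net Literature debt 0.
-/

noncomputable section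

open scoped BigOperators NumberField IsMulCommutative Classical
open NumberField IntermediateField

namespace Literature.AlgebraicGeometry.Pohlmann1968

namespace RankFormula

open Literature.NumberTheory.ComplexMultiplication
open Literature.NumberTheory.ComplexMultiplication.CMNumbers
open Literature.AlgebraicGeometry.Motives (CMType)
open Literature.AlgebraicGeometry.Pohlmann1968.CyclicTwoOddPrimes (isCMTypeWith_galType cmTypeRank_eq_typeRank_galType)
open Literature.AlgebraicGeometry.Pohlmann1968.AbelianKernels
open Literature.AlgebraicGeometry.Pohlmann1968.MixedDifferencesReading
open Literature.AlgebraicGeometry.Pohlmann1968.ExponentFourTimesPrime (cm_abelian_pow_eq_one_of_isCyclotomicExtension)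

/-! ## §1 The dictionary for the `2`-power classes: halving kernels of index `n` with cyclic quotient ⟺ equidistributed CM subfields of degree `n` with cyclic
Galois group -/

section Dictionary

variable {K : Type} [Field K] [NumberField K] [IsCMField K] [IsAbelianGalois ℚ K]

/-- **The halved kernels of index `n` with cyclic quotient ARE the CM subfields of degree `n` with cyclic Galois group over which `Φ` is equidistributed** (every
`τ : F → ℂ` has `[K:F]/2` extensions in `Φ`); the index-`4` case is the tree's `card_indexFour_eq_ncard_weilQuartic`. [cite: Gordon1999HodgeAVSurvey, 9.4.3 (Theorem [B.140])]
[cite: MilneFT2022, Thm. 3.16] [cite: Kubota1965, §4 Lemma 2] -/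
theorem card_index_isCyclic_halving_eq_ncard (φ₀ : K →+* ℂ) (Φ : CMType K) (n : ℕ) :
    ((Finset.univ : Finset (Subgroup (K ≃ₐ[ℚ] K))).filter fun H : Subgroup (K ≃ₐ[ℚ] K) =>
        (conjGal : K ≃ₐ[ℚ] K) ∉ H ∧ H.index = n ∧ IsCyclic ((K ≃ₐ[ℚ] K) ⧸ H) ∧
        ∀ g : K ≃ₐ[ℚ] K, 2 * (((Finset.univ.filter fun g : K ≃ₐ[ℚ] K => embOf φ₀ g ∈ Φ.1).filter
          fun s => g⁻¹ * s ∈ H).card) = Nat.card H).card =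
      {F : IntermediateField ℚ K | Module.finrank ℚ F = n ∧ ¬ IsTotallyReal F ∧ IsCyclic (F ≃ₐ[ℚ] F) ∧
        ∀ τ : F →+* ℂ, 2 * {φ : K →+* ℂ | φ.comp (algebraMap F K) = τ ∧ φ ∈ Φ.1}.ncard = Module.finrank F K}.ncard := by
  set B := (Finset.univ : Finset (Subgroup (K ≃ₐ[ℚ] K))).filter fun H : Subgroup (K ≃ₐ[ℚ] K) =>
    (conjGal : K ≃ₐ[ℚ] K) ∉ H ∧ H.index = n ∧ IsCyclic ((K ≃ₐ[ℚ] K) ⧸ H) ∧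
    ∀ g : K ≃ₐ[ℚ] K, 2 * (((Finset.univ.filter fun g : K ≃ₐ[ℚ] K => embOf φ₀ g ∈ Φ.1).filter
      fun s => g⁻¹ * s ∈ H).card) = Nat.card H with hB
  have hinj : Function.Injective (fun H : Subgroup (K ≃ₐ[ℚ] K) => fixedField H) := fun H H' hHH' => by
    have := congrArg IntermediateField.fixingSubgroup hHH'
    simpa only [fixingSubgroup_fixedField] using this
  have himage : (fun H : Subgroup (K ≃ₐ[ℚ] K) => fixedField H) '' (↑B : Set (Subgroup (K ≃ₐ[ℚ] K))) =
      {F : IntermediateField ℚ K | Module.finrank ℚ F = n ∧ ¬ IsTotallyReal F ∧ IsCyclic (F ≃ₐ[ℚ] F) ∧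
        ∀ τ : F →+* ℂ, 2 * {φ : K →+* ℂ | φ.comp (algebraMap F K) = τ ∧ φ ∈ Φ.1}.ncard = Module.finrank F K} := by
    ext F
    simp only [Set.mem_image, Finset.mem_coe, hB, Finset.mem_filter, Finset.mem_univ, true_and, Set.mem_setOf_eq]
    constructor
    · rintro ⟨H, ⟨hρH, hidx, hcyc, hhalf⟩, rfl⟩
      have hn : Module.finrank ℚ (fixedField H) = n := by rw [← index_eq_finrank_fixedField, hidx]
      have hF : ¬ IsTotallyReal (fixedField H) := (conjGal_not_mem_iff_not_isTotallyReal_fixedField H).1 hρH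
      refine ⟨hn, hF, (isCyclic_quotient_iff_isCyclic_gal_fixedField H).1 hcyc,
        (forall_two_mul_card_filter_eq_iff_forall_fibre φ₀ Φ (fixedField H)).1 ?_⟩
      simpa only [fixingSubgroup_fixedField] using hhalf
    · rintro ⟨hn, hF, hcyc, hW⟩
      refine ⟨F.fixingSubgroup, ⟨(conjGal_not_mem_fixingSubgroup_iff F).2 hF,
        by rw [CMNumbers.index_fixingSubgroup_eq_finrank F, hn], (isCyclic_quotient_fixingSubgroup_iff F).2 hcyc,
        (forall_two_mul_card_filter_eq_iff_forall_fibre φ₀ Φ F).2 hW⟩, IsGalois.fixedField_fixingSubgroup F⟩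
  rw [← himage, Set.ncard_image_of_injective _ hinj, Set.ncard_coe_finset]

/-- **«At NO halved kernel of index `n` (cyclic quotient)» ⟺ «over NO cyclic CM subfield of degree `n` is `Φ` equidistributed»** (the criterion clauses).
[cite: Gordon1999HodgeAVSurvey, 9.4.3 (Theorem [B.140])] [cite: MilneFT2022, Thm. 3.16] -/
theorem forall_subgroup_isCyclic_halving_iff_forall_intermediateField (φ₀ : K →+* ℂ) (Φ : CMType K) (n : ℕ) :
    (∀ H : Subgroup (K ≃ₐ[ℚ] K), (conjGal : K ≃ₐ[ℚ] K) ∉ H → H.index = n → IsCyclic ((K ≃ₐ[ℚ] K) ⧸ H) →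
        ¬ ∀ g : K ≃ₐ[ℚ] K, 2 * (((Finset.univ.filter fun g : K ≃ₐ[ℚ] K => embOf φ₀ g ∈ Φ.1).filter fun s => g⁻¹ * s ∈ H).card) =
          Nat.card H) ↔
      ∀ F : IntermediateField ℚ K, Module.finrank ℚ F = n → ¬ IsTotallyReal F → IsCyclic (F ≃ₐ[ℚ] F) →
        ¬ ∀ τ : F →+* ℂ, 2 * {φ : K →+* ℂ | φ.comp (algebraMap F K) = τ ∧ φ ∈ Φ.1}.ncard = Module.finrank F K := by
  constructor
  · intro h F hn hF hcyc hQ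
    exact h F.fixingSubgroup ((conjGal_not_mem_fixingSubgroup_iff F).2 hF)
      (by rw [CMNumbers.index_fixingSubgroup_eq_finrank, hn]) ((isCyclic_quotient_fixingSubgroup_iff F).2 hcyc)
      ((forall_two_mul_card_filter_eq_iff_forall_fibre φ₀ Φ F).2 hQ)
  · intro h H hρH hidx hcyc hQ
    refine h (fixedField H) (by rw [← index_eq_finrank_fixedField, hidx])
      ((conjGal_not_mem_iff_not_isTotallyReal_fixedField H).1 hρH) ((isCyclic_quotient_iff_isCyclic_gal_fixedField H).1 hcyc)
      ((forall_two_mul_card_filter_eq_iff_forall_fibre φ₀ Φ (fixedField H)).1 ?_)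
    simpa only [fixingSubgroup_fixedField] using hQ

end Dictionary

/-! ## §2 The rank formula and the nondegeneracy criterion: on `Gal(K/ℚ)` and on the lattice of subfields -/

section Subfields

variable {K : Type} [Field K] [NumberField K] [IsCMField K] [IsAbelianGalois ℚ K] {m r : ℕ}

/-- **The defect on `Gal(K/ℚ)` for an abelian CM field with `g^{2^{r+1}m} = 1`, `m` odd** — the lane's group-level F66k read on `Gal(K/ℚ)`.
[cite: Kubota1965, §4 Lemma 2] [cite: Dodson1984, §3.1.1 Theorem] [cite: Yanai2015IndexDegeneracy, Thm. 4.1] [cite: Hazama2003CyclicCM, Prop. 4.3 and Thm. 4.8]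
[cite: LamLeung2000, Thm. 2.2] -/
theorem cmTypeRank_add_card_kernels_eq (hodd : ¬ 2 ∣ m) (φ₀ : K →+* ℂ) (hexp : ∀ g : K ≃ₐ[ℚ] K, g ^ (2 ^ (r + 1) * m) = 1) (Φ : CMType K) :
    cmTypeRank Φ +
      ((Finset.univ : Finset (Subgroup (K ≃ₐ[ℚ] K))).filter fun H =>
        (conjGal : K ≃ₐ[ℚ] K) ∉ H ∧ H.index = 2 ∧
        ((Finset.univ.filter fun g : K ≃ₐ[ℚ] K => embOf φ₀ g ∈ Φ.1).filter fun s => s ∈ H).card =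
          ((Finset.univ.filter fun g : K ≃ₐ[ℚ] K => embOf φ₀ g ∈ Φ.1).filter fun s => s ∉ H).card).card +
      ∑ j ∈ Finset.Icc 2 (r + 1), (2 ^ j).totient *
        ((Finset.univ : Finset (Subgroup (K ≃ₐ[ℚ] K))).filter fun H : Subgroup (K ≃ₐ[ℚ] K) =>
          (conjGal : K ≃ₐ[ℚ] K) ∉ H ∧ H.index = 2 ^ j ∧ IsCyclic ((K ≃ₐ[ℚ] K) ⧸ H) ∧
          ∀ g : K ≃ₐ[ℚ] K, 2 * (((Finset.univ.filter fun g : K ≃ₐ[ℚ] K => embOf φ₀ g ∈ Φ.1).filter fun s => g⁻¹ * s ∈ H).card) =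
            Nat.card H).card +
      ∑ j ∈ Finset.Icc 1 (r + 1), ∑ d ∈ m.divisors.erase 1, (2 ^ j * d).totient *
          ((Finset.univ : Finset (Subgroup (K ≃ₐ[ℚ] K))).filter fun H => (conjGal : K ≃ₐ[ℚ] K) ∉ H ∧ H.index = 2 ^ j * d ∧
            IsCyclic ((K ≃ₐ[ℚ] K) ⧸ H) ∧
            ∀ (g : K ≃ₐ[ℚ] K) (x : ↥d.primeFactors → (K ≃ₐ[ℚ] K)), (∀ q, x q ^ (q : ℕ) ∈ H) →
              ∑ ε : ↥d.primeFactors → Bool, (∏ q, (if ε q then (-1 : ℤ) else 1)) *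
                (((Finset.univ.filter fun g : K ≃ₐ[ℚ] K => embOf φ₀ g ∈ Φ.1).filter
                  fun s => (g * ∏ q, (if ε q then x q else 1))⁻¹ * s ∈ H).card : ℤ) = 0).card =
      Module.finrank ℚ K / 2 + 1 := by
  rw [cmTypeRank_eq_typeRank_galType Φ φ₀, ← card_gal_eq_finrank φ₀]
  exact CyclicCMType.AbelianKernels.typeRank_add_card_kernels_eq_of_exponent hodd
    (isCMTypeWith_galType (AbelianCMFieldExistence.apply_conjGal_eq φ₀) Φ) hexp

/-- **THE RANK OF A CM TYPE OF AN ABELIAN CM FIELD, ON THE LATTICE OF SUBFIELDS** (`g^{2^{r+1}m} = 1` on `Gal(K/ℚ)`, `m` odd — every abelian CM field for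
suitable `r, m`).  For ANY CM type `Φ` of `K`,

  `Rank(Φ) + b(Φ) + Σ_{j=2}^{r+1} φ(2^j)·e_{2^j}(Φ) + Σ_{j=1}^{r+1} Σ_{d ∣ m, d ≠ 1} φ(2^j d)·s_{2^j d}(Φ) = [K:ℚ]/2 + 1`,

`b` = the imaginary quadratic subfields over which `Φ` is of Weil type; `e_{2^j}` = the CM subfields `F` of degree `2^j` with `Gal(F/ℚ)` cyclic every embedding of which
has `[K:F]/2` extensions in `Φ`; `s_{2^j d}` = the CM subfields `F` of degree `2^j d` with `Gal(F/ℚ)` cyclic over which `Φ` has vanishing mixed differences along the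
prime torsion of the odd part (for every family `σ_q ∈ Gal(F/ℚ)`, `q ∣ d` prime, `σ_q^q = 1`, and every `τ : F → ℂ`,
`Σ_{ε} (−1)^{|ε|} #{φ ∈ Φ : φ|_F = τ ∘ Π_{ε_q = 1} σ_q} = 0`). [cite: Kubota1965, §4 Lemma 2] [cite: Dodson1984, §3.1.1 Theorem] [cite: Yanai2015IndexDegeneracy, Thm. 4.1 (proof, p. 818)]
[cite: Gordon1999HodgeAVSurvey, 9.4.3] [cite: Hazama2003CyclicCM, Prop. 4.3 and Thm. 4.8] [cite: LamLeung2000, Thm. 2.2] -/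
theorem cmTypeRank_add_ncard_subfields_eq (hodd : ¬ 2 ∣ m) (hexp : ∀ g : K ≃ₐ[ℚ] K, g ^ (2 ^ (r + 1) * m) = 1) (Φ : CMType K) :
    cmTypeRank Φ + {F : IntermediateField ℚ K | Module.finrank ℚ F = 2 ∧ ¬ IsTotallyReal F ∧
        ∀ τ : F →+* ℂ, {φ : K →+* ℂ | φ.comp (algebraMap F K) = τ ∧ φ ∈ Φ.1}.ncard =
          {φ : K →+* ℂ | φ.comp (algebraMap F K) = τ ∧ φ ∉ Φ.1}.ncard}.ncard +
      ∑ j ∈ Finset.Icc 2 (r + 1), (2 ^ j).totient *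
        {F : IntermediateField ℚ K | Module.finrank ℚ F = 2 ^ j ∧ ¬ IsTotallyReal F ∧ IsCyclic (F ≃ₐ[ℚ] F) ∧
          ∀ τ : F →+* ℂ, 2 * {φ : K →+* ℂ | φ.comp (algebraMap F K) = τ ∧ φ ∈ Φ.1}.ncard = Module.finrank F K}.ncard +
      ∑ j ∈ Finset.Icc 1 (r + 1), ∑ d ∈ m.divisors.erase 1, (2 ^ j * d).totient *
          {F : IntermediateField ℚ K | Module.finrank ℚ F = 2 ^ j * d ∧ ¬ IsTotallyReal F ∧ IsCyclic (F ≃ₐ[ℚ] F) ∧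
            ∀ [IsAbelianGalois ℚ F] (σ : ↥d.primeFactors → (F ≃ₐ[ℚ] F)), (∀ q, σ q ^ (q : ℕ) = 1) → ∀ τ : F →+* ℂ,
              ∑ ε : ↥d.primeFactors → Bool, (∏ q, (if ε q then (-1 : ℤ) else 1)) *
                ({φ : K →+* ℂ | φ.comp (algebraMap F K) = τ.comp (∏ q, (if ε q then σ q else 1)).toRingEquiv.toRingHom ∧
                  φ ∈ Φ.1}.ncard : ℤ) = 0}.ncard = Module.finrank ℚ K / 2 + 1 := by
  obtain ⟨φ₀⟩ := (inferInstance : Nonempty (K →+* ℂ))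
  rw [← card_indexTwo_eq_ncard_weilQuadratic φ₀ Φ, ← cmTypeRank_add_card_kernels_eq hodd φ₀ hexp Φ]
  congr 1
  · congr 1
    refine Finset.sum_congr rfl fun j _ => ?_
    rw [card_index_isCyclic_halving_eq_ncard φ₀ Φ (2 ^ j)]
  · refine Finset.sum_congr rfl fun j _ => Finset.sum_congr rfl fun d _ => ?_
    rw [card_index_isCyclic_eq_ncard_mixed φ₀ Φ (fun q : ↥d.primeFactors => (q : ℕ)) (2 ^ j * d)]

/-- **NONDEGENERACY CRITERION ON THE LATTICE OF SUBFIELDS — ANY ABELIAN CM FIELD** (`g^{2^{r+1}m} = 1` on `Gal(K/ℚ)`, `m` odd).  `Φ` is NONDEGENERATE iff (i) it is of Weil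
type over NO imaginary quadratic subfield, (ii) for `2 ≤ j ≤ r+1` it is equidistributed over NO CM subfield of degree `2^j` with cyclic Galois group, and (iii) for
`1 ≤ j ≤ r+1` and every divisor `d ≠ 1` of `m`, over NO CM subfield of degree `2^j d` with cyclic Galois group do all its mixed differences along the prime torsion of
the odd part vanish. [cite: Kubota1965, §4 Lemma 2] [cite: Dodson1984, §3.1.1 Theorem] [cite: Yanai2015IndexDegeneracy, Thm. 4.1] [cite: Hazama2003CyclicCM, Prop. 4.3 and Thm. 4.8] -/
theorem isNondegenerate_iff_forall_intermediateField (hodd : ¬ 2 ∣ m) (hexp : ∀ g : K ≃ₐ[ℚ] K, g ^ (2 ^ (r + 1) * m) = 1) (Φ : CMType K) :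
    IsNondegenerate Φ ↔
      (∀ F : IntermediateField ℚ K, Module.finrank ℚ F = 2 → ¬ IsTotallyReal F →
        ¬ ∀ τ : F →+* ℂ, {φ : K →+* ℂ | φ.comp (algebraMap F K) = τ ∧ φ ∈ Φ.1}.ncard =
          {φ : K →+* ℂ | φ.comp (algebraMap F K) = τ ∧ φ ∉ Φ.1}.ncard) ∧
      (∀ j ∈ Finset.Icc 2 (r + 1), ∀ F : IntermediateField ℚ K, Module.finrank ℚ F = 2 ^ j → ¬ IsTotallyReal F → IsCyclic (F ≃ₐ[ℚ] F) →
        ¬ ∀ τ : F →+* ℂ, 2 * {φ : K →+* ℂ | φ.comp (algebraMap F K) = τ ∧ φ ∈ Φ.1}.ncard = Module.finrank F K) ∧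
      (∀ j ∈ Finset.Icc 1 (r + 1), ∀ d : ℕ, d ∣ m → d ≠ 1 → ∀ F : IntermediateField ℚ K, Module.finrank ℚ F = 2 ^ j * d → ¬ IsTotallyReal F →
        IsCyclic (F ≃ₐ[ℚ] F) → ∀ [IsAbelianGalois ℚ F],
        ¬ ∀ σ : ↥d.primeFactors → (F ≃ₐ[ℚ] F), (∀ q, σ q ^ (q : ℕ) = 1) → ∀ τ : F →+* ℂ,
          ∑ ε : ↥d.primeFactors → Bool, (∏ q, (if ε q then (-1 : ℤ) else 1)) *
            ({φ : K →+* ℂ | φ.comp (algebraMap F K) = τ.comp (∏ q, (if ε q then σ q else 1)).toRingEquiv.toRingHom ∧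
              φ ∈ Φ.1}.ncard : ℤ) = 0) := by
  obtain ⟨φ₀⟩ := (inferInstance : Nonempty (K →+* ℂ))
  rw [Pohlmann1968.isNondegenerate_iff Φ, cmTypeRank_eq_typeRank_galType Φ φ₀, ← card_gal_eq_finrank φ₀,
    CyclicCMType.AbelianKernels.typeRank_eq_iff_of_exponent hodd (isCMTypeWith_galType (AbelianCMFieldExistence.apply_conjGal_eq φ₀) Φ) hexp]
  refine and_congr ?_ (and_congr ?_ ?_)
  · constructor
    · intro h F h2 hF hW
      have hρH : (conjGal : K ≃ₐ[ℚ] K) ∉ F.fixingSubgroup := (conjGal_not_mem_fixingSubgroup_iff F).2 hF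
      exact h F.fixingSubgroup hρH (index_fixingSubgroup_eq_two F h2) ((card_filter_mem_eq_iff_balanced φ₀ Φ F h2 hF).2 hW)
    · intro h H hρH hidx hsplit
      have h2 : Module.finrank ℚ (fixedField H) = 2 := by rw [← index_eq_finrank_fixedField, hidx]
      have hF : ¬ IsTotallyReal (fixedField H) := (conjGal_not_mem_iff_not_isTotallyReal_fixedField H).1 hρH
      refine h (fixedField H) h2 hF ((card_filter_mem_eq_iff_balanced φ₀ Φ (fixedField H) h2 hF).1 ?_)
      simpa only [fixingSubgroup_fixedField] using hsplit
  · refine forall_congr' fun j => forall_congr' fun _ => ?_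
    exact forall_subgroup_isCyclic_halving_iff_forall_intermediateField φ₀ Φ (2 ^ j)
  · refine forall_congr' fun j => forall_congr' fun _ => forall_congr' fun d => forall_congr' fun _ => forall_congr' fun _ => ?_
    exact forall_subgroup_isCyclic_iff_forall_intermediateField_mixed φ₀ Φ (fun q : ↥d.primeFactors => (q : ℕ)) (2 ^ j * d)

/-! ### §2b The hypothesis-free forms: `2^{r+1}m := [K:ℚ]` (`r + 1 = v₂[K:ℚ]`, `m` the odd part of `[K:ℚ]`) -/

/-- `[K:ℚ] = 2^{v₂[K:ℚ]}·oddpart[K:ℚ]` with `v₂[K:ℚ] ≥ 1` (complex conjugation has order `2` in `Gal(K/ℚ)`), and `g^{[K:ℚ]} = 1` on `Gal(K/ℚ)`. [folklore] -/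
private theorem finrank_eq_two_pow_mul_rf (φ₀ : K →+* ℂ) (Φ : CMType K) :
    1 ≤ (Module.finrank ℚ K).factorization 2 ∧ ¬ 2 ∣ ordCompl[2] (Module.finrank ℚ K) ∧
      ∀ g : K ≃ₐ[ℚ] K, g ^ (2 ^ ((Module.finrank ℚ K).factorization 2 - 1 + 1) * ordCompl[2] (Module.finrank ℚ K)) = 1 := by
  have hcard : Fintype.card (K ≃ₐ[ℚ] K) = Module.finrank ℚ K := card_gal_eq_finrank φ₀
  have hT := isCMTypeWith_galType (AbelianCMFieldExistence.apply_conjGal_eq φ₀) Φ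
  have hρ1 : (conjGal : K ≃ₐ[ℚ] K) ≠ 1 := by
    intro hρ
    have := hT.rho_smul_ne (1 : K ≃ₐ[ℚ] K)
    rw [hρ, smul_eq_mul, one_mul] at this
    exact this rfl
  have hρ2 : (conjGal : K ≃ₐ[ℚ] K) * conjGal = 1 := by simpa [smul_eq_mul] using hT.invol (1 : K ≃ₐ[ℚ] K)
  have hord : orderOf (conjGal : K ≃ₐ[ℚ] K) = 2 := by
    haveI : Fact (Nat.Prime 2) := ⟨Nat.prime_two⟩
    exact orderOf_eq_prime (by rw [pow_two, hρ2]) hρ1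
  have hN0 : Module.finrank ℚ K ≠ 0 := Module.finrank_pos.ne'
  have h2 : 2 ∣ Module.finrank ℚ K := by rw [← hcard, ← hord]; exact orderOf_dvd_card
  have hv : 1 ≤ (Module.finrank ℚ K).factorization 2 :=
    Nat.one_le_iff_ne_zero.2 (Nat.Prime.factorization_pos_of_dvd Nat.prime_two hN0 h2).ne'
  have hN : Module.finrank ℚ K = 2 ^ ((Module.finrank ℚ K).factorization 2 - 1 + 1) * ordCompl[2] (Module.finrank ℚ K) := by
    rw [Nat.sub_add_cancel hv]
    exact (Nat.ordProj_mul_ordCompl_eq_self _ 2).symm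
  refine ⟨hv, Nat.not_dvd_ordCompl Nat.prime_two hN0, fun g => ?_⟩
  rw [← hN, ← hcard]
  exact pow_card_eq_one

/-- **THE RANK OF A CM TYPE OF ANY ABELIAN CM FIELD, ON THE LATTICE OF SUBFIELDS — HYPOTHESIS-FREE FORM.**  For every CM field `K` abelian over `ℚ` and every CM type
`Φ` of `K`, with `v = v₂[K:ℚ]` and `m` the odd part of `[K:ℚ]`:

  `Rank(Φ) + b(Φ) + Σ_{j=2}^{v} φ(2^j)·e_{2^j}(Φ) + Σ_{j=1}^{v} Σ_{d ∣ m, d ≠ 1} φ(2^j d)·s_{2^j d}(Φ) = [K:ℚ]/2 + 1`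

(sets as in `cmTypeRank_add_ncard_subfields_eq`; every CM subfield with cyclic Galois group has degree `2^j d` with `j ≤ v`, `d ∣ m`). [cite: Kubota1965, §4 Lemma 2]
[cite: Dodson1984, §3.1.1 Theorem] [cite: Yanai2015IndexDegeneracy, Thm. 4.1 (proof, p. 818)] [cite: Gordon1999HodgeAVSurvey, 9.4.3] [cite: Hazama2003CyclicCM, Prop. 4.3 and Thm. 4.8]
[cite: LamLeung2000, Thm. 2.2] -/
theorem cmTypeRank_add_ncard_subfields_eq_finrank (Φ : CMType K) :
    cmTypeRank Φ + {F : IntermediateField ℚ K | Module.finrank ℚ F = 2 ∧ ¬ IsTotallyReal F ∧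
        ∀ τ : F →+* ℂ, {φ : K →+* ℂ | φ.comp (algebraMap F K) = τ ∧ φ ∈ Φ.1}.ncard =
          {φ : K →+* ℂ | φ.comp (algebraMap F K) = τ ∧ φ ∉ Φ.1}.ncard}.ncard +
      ∑ j ∈ Finset.Icc 2 ((Module.finrank ℚ K).factorization 2), (2 ^ j).totient *
        {F : IntermediateField ℚ K | Module.finrank ℚ F = 2 ^ j ∧ ¬ IsTotallyReal F ∧ IsCyclic (F ≃ₐ[ℚ] F) ∧
          ∀ τ : F →+* ℂ, 2 * {φ : K →+* ℂ | φ.comp (algebraMap F K) = τ ∧ φ ∈ Φ.1}.ncard = Module.finrank F K}.ncard +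
      ∑ j ∈ Finset.Icc 1 ((Module.finrank ℚ K).factorization 2), ∑ d ∈ (ordCompl[2] (Module.finrank ℚ K)).divisors.erase 1, (2 ^ j * d).totient *
          {F : IntermediateField ℚ K | Module.finrank ℚ F = 2 ^ j * d ∧ ¬ IsTotallyReal F ∧ IsCyclic (F ≃ₐ[ℚ] F) ∧
            ∀ [IsAbelianGalois ℚ F] (σ : ↥d.primeFactors → (F ≃ₐ[ℚ] F)), (∀ q, σ q ^ (q : ℕ) = 1) → ∀ τ : F →+* ℂ,
              ∑ ε : ↥d.primeFactors → Bool, (∏ q, (if ε q then (-1 : ℤ) else 1)) *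
                ({φ : K →+* ℂ | φ.comp (algebraMap F K) = τ.comp (∏ q, (if ε q then σ q else 1)).toRingEquiv.toRingHom ∧
                  φ ∈ Φ.1}.ncard : ℤ) = 0}.ncard = Module.finrank ℚ K / 2 + 1 := by
  obtain ⟨φ₀⟩ := (inferInstance : Nonempty (K →+* ℂ))
  obtain ⟨hv, hodd, hexp⟩ := finrank_eq_two_pow_mul_rf φ₀ Φ
  have key := cmTypeRank_add_ncard_subfields_eq hodd hexp Φ
  rwa [Nat.sub_add_cancel hv] at key

/-- **NONDEGENERACY CRITERION — ANY ABELIAN CM FIELD, HYPOTHESIS-FREE FORM** (`v = v₂[K:ℚ]`, `m` = odd part of `[K:ℚ]`): `Φ` is NONDEGENERATE iff it is of Weil type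
over no imaginary quadratic subfield, equidistributed over no CM subfield of degree `2^j` (`2 ≤ j ≤ v`) with cyclic Galois group, and has non-vanishing mixed
differences along the prime torsion over every CM subfield of degree `2^j d` (`1 ≤ j ≤ v`, `1 ≠ d ∣ m`) with cyclic Galois group. [cite: Kubota1965, §4 Lemma 2]
[cite: Dodson1984, §3.1.1 Theorem] [cite: Yanai2015IndexDegeneracy, Thm. 4.1] [cite: Hazama2003CyclicCM, Prop. 4.3 and Thm. 4.8] -/
theorem isNondegenerate_iff_forall_intermediateField_finrank (Φ : CMType K) :
    IsNondegenerate Φ ↔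
      (∀ F : IntermediateField ℚ K, Module.finrank ℚ F = 2 → ¬ IsTotallyReal F →
        ¬ ∀ τ : F →+* ℂ, {φ : K →+* ℂ | φ.comp (algebraMap F K) = τ ∧ φ ∈ Φ.1}.ncard =
          {φ : K →+* ℂ | φ.comp (algebraMap F K) = τ ∧ φ ∉ Φ.1}.ncard) ∧
      (∀ j ∈ Finset.Icc 2 ((Module.finrank ℚ K).factorization 2), ∀ F : IntermediateField ℚ K, Module.finrank ℚ F = 2 ^ j → ¬ IsTotallyReal F →
        IsCyclic (F ≃ₐ[ℚ] F) → ¬ ∀ τ : F →+* ℂ, 2 * {φ : K →+* ℂ | φ.comp (algebraMap F K) = τ ∧ φ ∈ Φ.1}.ncard = Module.finrank F K) ∧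
      (∀ j ∈ Finset.Icc 1 ((Module.finrank ℚ K).factorization 2), ∀ d : ℕ, d ∣ ordCompl[2] (Module.finrank ℚ K) → d ≠ 1 → ∀ F : IntermediateField ℚ K,
        Module.finrank ℚ F = 2 ^ j * d → ¬ IsTotallyReal F → IsCyclic (F ≃ₐ[ℚ] F) → ∀ [IsAbelianGalois ℚ F],
        ¬ ∀ σ : ↥d.primeFactors → (F ≃ₐ[ℚ] F), (∀ q, σ q ^ (q : ℕ) = 1) → ∀ τ : F →+* ℂ,
          ∑ ε : ↥d.primeFactors → Bool, (∏ q, (if ε q then (-1 : ℤ) else 1)) *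
            ({φ : K →+* ℂ | φ.comp (algebraMap F K) = τ.comp (∏ q, (if ε q then σ q else 1)).toRingEquiv.toRingHom ∧
              φ ∈ Φ.1}.ncard : ℤ) = 0) := by
  obtain ⟨φ₀⟩ := (inferInstance : Nonempty (K →+* ℂ))
  obtain ⟨hv, hodd, hexp⟩ := finrank_eq_two_pow_mul_rf φ₀ Φ
  have key := isNondegenerate_iff_forall_intermediateField hodd hexp Φ
  rwa [Nat.sub_add_cancel hv] at key

end Subfields

/-! ## §3 Consequences for abelian varieties: `B•(Aⁿ) ⊗ ℂ = D•(Aⁿ) ⊗ ℂ` and the Hodge conjecture for all powers off the subfield lists -/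

section Varieties

open Literature.AlgebraicGeometry.Motives (AbelianVariety)
open Literature.AlgebraicGeometry.HodgeTheory
open Literature.AlgebraicGeometry.ComplexMultiplication (IsCMTypeRealisation)
open Literature.AlgebraicGeometry.VanGeemen1994 (hodgeClassSpan)
open Literature.Barriers.HodgeConjecture (divisorClassesSpan)
open _root_.CategoryTheory _root_.CategoryTheory.Limits

variable {K : Type} [Field K] [NumberField K] [IsCMField K] [IsAbelianGalois ℚ K] {m r : ℕ}
  {Φ : CMType K} {A : AbelianVariety ℂ} {ι : 𝓞 K →+* End A} {θ : K →+* Module.End ℂ (complexBetti A.X 1)}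

/-- `Bᵐ ⊗ ℂ = Dᵐ ⊗ ℂ` for all `m` on an abelian variety gives the Hodge conjecture for it (Lefschetz `(1,1)`, cup products, tree theorems).
[cite: Gordon1999HodgeAVSurvey, §9.3] -/
private theorem hodgeConjectureFor_of_forall_hodgeClassSpan_eq_rf (B : AbelianVariety ℂ)
    (h : ∀ n : ℕ, hodgeClassSpan B.dim B.X n = divisorClassesSpan B.X B.dim n) : HodgeConjectureFor B.dim B.X :=
  ⟨nonempty_hodgeModel_holds (Motives.AbelianVariety.isSmoothProjective_holds (A := B)),
    fun n _ hc hmm ↦ AbelianVariety.divisorClassesSpan_le_algebraicClasses B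
      (fun b hb hb' ↦ lefschetzOneOne_rational_holds (Motives.AbelianVariety.isSmoothProjective_holds (A := B)) b hb hb') n
      ((h n) ▸ Submodule.subset_span ⟨hc, hmm⟩)⟩

/-- **`B•(Aⁿ) ⊗ ℂ = D•(Aⁿ) ⊗ ℂ` FOR EVERY REALISATION OF A TYPE OFF THE SUBFIELD LISTS — ANY ABELIAN CM FIELD** (`g^{2^{r+1}m} = 1` on `Gal`, `m` odd).
[cite: Kubota1965, §4 Lemma 2] [cite: Gordon1999HodgeAVSurvey, Thm. 6.4 and §9.3] [cite: Hazama2003CyclicCM, Prop. 4.3 and Thm. 4.8] [cite: Yanai2015IndexDegeneracy, Thm. 4.1] -/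
theorem hodgeClassSpan_pow_eq_divisorClassesSpan_of_forall_intermediateField (hodd : ¬ 2 ∣ m) (hexp : ∀ g : K ≃ₐ[ℚ] K, g ^ (2 ^ (r + 1) * m) = 1)
    (hW : ∀ F : IntermediateField ℚ K, Module.finrank ℚ F = 2 → ¬ IsTotallyReal F →
        ¬ ∀ τ : F →+* ℂ, {φ : K →+* ℂ | φ.comp (algebraMap F K) = τ ∧ φ ∈ Φ.1}.ncard =
          {φ : K →+* ℂ | φ.comp (algebraMap F K) = τ ∧ φ ∉ Φ.1}.ncard)
    (hP : ∀ j ∈ Finset.Icc 2 (r + 1), ∀ F : IntermediateField ℚ K, Module.finrank ℚ F = 2 ^ j → ¬ IsTotallyReal F → IsCyclic (F ≃ₐ[ℚ] F) →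
        ¬ ∀ τ : F →+* ℂ, 2 * {φ : K →+* ℂ | φ.comp (algebraMap F K) = τ ∧ φ ∈ Φ.1}.ncard = Module.finrank F K)
    (hD : ∀ j ∈ Finset.Icc 1 (r + 1), ∀ d : ℕ, d ∣ m → d ≠ 1 → ∀ F : IntermediateField ℚ K, Module.finrank ℚ F = 2 ^ j * d → ¬ IsTotallyReal F →
        IsCyclic (F ≃ₐ[ℚ] F) → ∀ [IsAbelianGalois ℚ F],
        ¬ ∀ σ : ↥d.primeFactors → (F ≃ₐ[ℚ] F), (∀ q, σ q ^ (q : ℕ) = 1) → ∀ τ : F →+* ℂ,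
          ∑ ε : ↥d.primeFactors → Bool, (∏ q, (if ε q then (-1 : ℤ) else 1)) *
            ({φ : K →+* ℂ | φ.comp (algebraMap F K) = τ.comp (∏ q, (if ε q then σ q else 1)).toRingEquiv.toRingHom ∧
              φ ∈ Φ.1}.ncard : ℤ) = 0)
    (hA : IsCMTypeRealisation Φ A ι θ) (n k : ℕ) :
    hodgeClassSpan (⨁ fun _ : Fin n => A).dim (⨁ fun _ : Fin n => A).X k =
      divisorClassesSpan (⨁ fun _ : Fin n => A).X (⨁ fun _ : Fin n => A).dim k :=
  ((isNondegenerate_iff_forall_intermediateField hodd hexp Φ).2 ⟨hW, hP, hD⟩).hodgeClassSpan_pow_eq_divisorClassesSpan hA n k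

/-- **THE HODGE CONJECTURE FOR ALL POWERS OF EVERY REALISATION OF A TYPE OFF THE SUBFIELD LISTS — ANY ABELIAN CM FIELD** (`g^{2^{r+1}m} = 1` on `Gal`, `m` odd) —
UNCONDITIONAL, any realisation, hypotheses on the lattice of subfields only. [cite: Gordon1999HodgeAVSurvey, Thm. 6.4 and §9.3] [cite: Kubota1965, §4 Lemma 2]
[cite: Deligne2000, §1] -/
theorem hodgeConjectureFor_pow_of_forall_intermediateField (hodd : ¬ 2 ∣ m) (hexp : ∀ g : K ≃ₐ[ℚ] K, g ^ (2 ^ (r + 1) * m) = 1)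
    (hW : ∀ F : IntermediateField ℚ K, Module.finrank ℚ F = 2 → ¬ IsTotallyReal F →
        ¬ ∀ τ : F →+* ℂ, {φ : K →+* ℂ | φ.comp (algebraMap F K) = τ ∧ φ ∈ Φ.1}.ncard =
          {φ : K →+* ℂ | φ.comp (algebraMap F K) = τ ∧ φ ∉ Φ.1}.ncard)
    (hP : ∀ j ∈ Finset.Icc 2 (r + 1), ∀ F : IntermediateField ℚ K, Module.finrank ℚ F = 2 ^ j → ¬ IsTotallyReal F → IsCyclic (F ≃ₐ[ℚ] F) →
        ¬ ∀ τ : F →+* ℂ, 2 * {φ : K →+* ℂ | φ.comp (algebraMap F K) = τ ∧ φ ∈ Φ.1}.ncard = Module.finrank F K)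
    (hD : ∀ j ∈ Finset.Icc 1 (r + 1), ∀ d : ℕ, d ∣ m → d ≠ 1 → ∀ F : IntermediateField ℚ K, Module.finrank ℚ F = 2 ^ j * d → ¬ IsTotallyReal F →
        IsCyclic (F ≃ₐ[ℚ] F) → ∀ [IsAbelianGalois ℚ F],
        ¬ ∀ σ : ↥d.primeFactors → (F ≃ₐ[ℚ] F), (∀ q, σ q ^ (q : ℕ) = 1) → ∀ τ : F →+* ℂ,
          ∑ ε : ↥d.primeFactors → Bool, (∏ q, (if ε q then (-1 : ℤ) else 1)) *
            ({φ : K →+* ℂ | φ.comp (algebraMap F K) = τ.comp (∏ q, (if ε q then σ q else 1)).toRingEquiv.toRingHom ∧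
              φ ∈ Φ.1}.ncard : ℤ) = 0)
    (hA : IsCMTypeRealisation Φ A ι θ) (n : ℕ) :
    HodgeConjectureFor (⨁ fun _ : Fin n => A).dim (⨁ fun _ : Fin n => A).X :=
  hodgeConjectureFor_of_forall_hodgeClassSpan_eq_rf _
    fun k ↦ hodgeClassSpan_pow_eq_divisorClassesSpan_of_forall_intermediateField hodd hexp hW hP hD hA n k

end Varieties

/-! ## §4 The cyclotomic fields `ℚ(ζ_N)`; the levels `41`, `73`, `119` (`2`-exponents `8`, `8`, `16`; `φ(73) = 72`, `φ(119) = 96`) -/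

section Cyclotomic

open Literature.AlgebraicGeometry.Motives (AbelianVariety)
open Literature.AlgebraicGeometry.HodgeTheory
open Literature.AlgebraicGeometry.ComplexMultiplication (IsCMTypeRealisation)
open _root_.CategoryTheory _root_.CategoryTheory.Limits

variable {N m r : ℕ} {L : Type} [Field L] [NumberField L]
  {Φ : CMType L} {A : AbelianVariety ℂ} {ι : 𝓞 L →+* End A} {θ : L →+* Module.End ℂ (complexBetti A.X 1)}

/-- **The Hodge conjecture for all powers of every abelian variety with CM by `ℚ(ζ_N)`, `(ℤ/N)ˣ` of exponent dividing `2^{r+1}m` (`m` odd), whose type is off the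
subfield lists.**  Instance hypotheses `[IsCMField L] [IsAbelianGalois ℚ L]` as in the neighbours (true for `ℚ(ζ_N)`, `N > 2`). [cite: Gordon1999HodgeAVSurvey, Thm. 6.4 and §9.3]
[cite: Washington1997, Ch. 2 Thm. 2.5] -/
theorem hodgeConjectureFor_pow_of_forall_intermediateField_of_isCyclotomicExtension [NeZero N] [IsCyclotomicExtension {N} ℚ L]
    [IsCMField L] [IsAbelianGalois ℚ L] (h2N : 2 < N) (hodd : ¬ 2 ∣ m) (hN : ∀ u : (ZMod N)ˣ, u ^ (2 ^ (r + 1) * m) = 1)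
    (hW : ∀ F : IntermediateField ℚ L, Module.finrank ℚ F = 2 → ¬ IsTotallyReal F →
        ¬ ∀ τ : F →+* ℂ, {φ : L →+* ℂ | φ.comp (algebraMap F L) = τ ∧ φ ∈ Φ.1}.ncard =
          {φ : L →+* ℂ | φ.comp (algebraMap F L) = τ ∧ φ ∉ Φ.1}.ncard)
    (hP : ∀ j ∈ Finset.Icc 2 (r + 1), ∀ F : IntermediateField ℚ L, Module.finrank ℚ F = 2 ^ j → ¬ IsTotallyReal F → IsCyclic (F ≃ₐ[ℚ] F) →
        ¬ ∀ τ : F →+* ℂ, 2 * {φ : L →+* ℂ | φ.comp (algebraMap F L) = τ ∧ φ ∈ Φ.1}.ncard = Module.finrank F L)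
    (hD : ∀ j ∈ Finset.Icc 1 (r + 1), ∀ d : ℕ, d ∣ m → d ≠ 1 → ∀ F : IntermediateField ℚ L, Module.finrank ℚ F = 2 ^ j * d → ¬ IsTotallyReal F →
        IsCyclic (F ≃ₐ[ℚ] F) → ∀ [IsAbelianGalois ℚ F],
        ¬ ∀ σ : ↥d.primeFactors → (F ≃ₐ[ℚ] F), (∀ q, σ q ^ (q : ℕ) = 1) → ∀ τ : F →+* ℂ,
          ∑ ε : ↥d.primeFactors → Bool, (∏ q, (if ε q then (-1 : ℤ) else 1)) *
            ({φ : L →+* ℂ | φ.comp (algebraMap F L) = τ.comp (∏ q, (if ε q then σ q else 1)).toRingEquiv.toRingHom ∧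
              φ ∈ Φ.1}.ncard : ℤ) = 0)
    (hA : IsCMTypeRealisation Φ A ι θ) (n : ℕ) :
    HodgeConjectureFor (⨁ fun _ : Fin n => A).dim (⨁ fun _ : Fin n => A).X :=
  hodgeConjectureFor_pow_of_forall_intermediateField hodd (cm_abelian_pow_eq_one_of_isCyclotomicExtension h2N hN L).2.2.1 hW hP hD hA n

/-- `u⁴⁰ = 1` for every unit of `ℤ/41` (`41` prime, `40 = 2³·5`). [cite: Washington1997, Ch. 2 Thm. 2.5] -/
theorem units_pow_forty_fortyOne (u : (ZMod 41)ˣ) : u ^ (2 ^ (2 + 1) * 5) = 1 := by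
  have h : ∀ a : ZMod 41, Nat.Coprime a.val 41 → a ^ (2 ^ (2 + 1) * 5) = 1 := by decide +kernel
  exact Units.ext (by rw [Units.val_pow_eq_pow_val, h _ (ZMod.val_coe_unit_coprime u), Units.val_one])

/-- `u⁷² = 1` for every unit of `ℤ/73` (`73` prime, `72 = 2³·3²`). [cite: Washington1997, Ch. 2 Thm. 2.5] -/
theorem units_pow_seventyTwo_seventyThree (u : (ZMod 73)ˣ) : u ^ (2 ^ (2 + 1) * 9) = 1 := by
  have h : ∀ a : ZMod 73, Nat.Coprime a.val 73 → a ^ (2 ^ (2 + 1) * 9) = 1 := by decide +kernel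
  exact Units.ext (by rw [Units.val_pow_eq_pow_val, h _ (ZMod.val_coe_unit_coprime u), Units.val_one])

/-- `u⁴⁸ = 1` for every unit of `ℤ/119` (`119 = 7·17`, `(ℤ/119)ˣ ≅ ℤ/6 × ℤ/16` of exponent `48 = 2⁴·3`). [cite: Washington1997, Ch. 2 Thm. 2.5] -/
theorem units_pow_fortyEight_oneHundredNineteen (u : (ZMod 119)ˣ) : u ^ (2 ^ (3 + 1) * 3) = 1 := by
  have h : ∀ a : ZMod 119, Nat.Coprime a.val 119 → a ^ (2 ^ (3 + 1) * 3) = 1 := by decide +kernel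
  exact Units.ext (by rw [Units.val_pow_eq_pow_val, h _ (ZMod.val_coe_unit_coprime u), Units.val_one])

/-- **`ℚ(ζ₄₁)`** (CM `20`-folds; `Gal ≅ ℤ/40`, `40 = 2³·5`: lists `b`, `e₄`, `e₈`, `s_{10}, s_{20}, s_{40}`): the Hodge conjecture for all powers of every abelian variety of a
type off the subfield lists — UNCONDITIONAL. [cite: Gordon1999HodgeAVSurvey, Thm. 6.4 and §9.3] [cite: Kubota1965, §4 Lemma 2] [cite: Hazama2003CyclicCM, Thm. 4.8]
[cite: Washington1997, Ch. 2 Thm. 2.5] -/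
theorem hodgeConjectureFor_pow_of_forall_intermediateField_fortyOne [IsCyclotomicExtension {41} ℚ L] [IsCMField L] [IsAbelianGalois ℚ L]
    (hW : ∀ F : IntermediateField ℚ L, Module.finrank ℚ F = 2 → ¬ IsTotallyReal F →
        ¬ ∀ τ : F →+* ℂ, {φ : L →+* ℂ | φ.comp (algebraMap F L) = τ ∧ φ ∈ Φ.1}.ncard =
          {φ : L →+* ℂ | φ.comp (algebraMap F L) = τ ∧ φ ∉ Φ.1}.ncard)
    (hP : ∀ j ∈ Finset.Icc 2 (2 + 1), ∀ F : IntermediateField ℚ L, Module.finrank ℚ F = 2 ^ j → ¬ IsTotallyReal F → IsCyclic (F ≃ₐ[ℚ] F) →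
        ¬ ∀ τ : F →+* ℂ, 2 * {φ : L →+* ℂ | φ.comp (algebraMap F L) = τ ∧ φ ∈ Φ.1}.ncard = Module.finrank F L)
    (hD : ∀ j ∈ Finset.Icc 1 (2 + 1), ∀ d : ℕ, d ∣ 5 → d ≠ 1 → ∀ F : IntermediateField ℚ L, Module.finrank ℚ F = 2 ^ j * d → ¬ IsTotallyReal F →
        IsCyclic (F ≃ₐ[ℚ] F) → ∀ [IsAbelianGalois ℚ F],
        ¬ ∀ σ : ↥d.primeFactors → (F ≃ₐ[ℚ] F), (∀ q, σ q ^ (q : ℕ) = 1) → ∀ τ : F →+* ℂ,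
          ∑ ε : ↥d.primeFactors → Bool, (∏ q, (if ε q then (-1 : ℤ) else 1)) *
            ({φ : L →+* ℂ | φ.comp (algebraMap F L) = τ.comp (∏ q, (if ε q then σ q else 1)).toRingEquiv.toRingHom ∧
              φ ∈ Φ.1}.ncard : ℤ) = 0)
    (hA : IsCMTypeRealisation Φ A ι θ) (n : ℕ) :
    HodgeConjectureFor (⨁ fun _ : Fin n => A).dim (⨁ fun _ : Fin n => A).X :=
  haveI : NeZero (41 : ℕ) := ⟨by norm_num⟩
  hodgeConjectureFor_pow_of_forall_intermediateField_of_isCyclotomicExtension (N := 41) (m := 5) (r := 2) (by norm_num) (by norm_num)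
    units_pow_forty_fortyOne hW hP hD hA n

/-- **`ℚ(ζ₇₃)`** (CM `36`-folds; `Gal ≅ ℤ/72`, `72 = 2³·3²`, `φ(73) = 72`: lists `b`, `e₄`, `e₈`, `s_{2^j d}` for `d ∈ {3, 9}`, `j ≤ 3`): the Hodge conjecture for all powers
of every abelian variety of a type off the subfield lists — UNCONDITIONAL. [cite: Gordon1999HodgeAVSurvey, Thm. 6.4 and §9.3] [cite: Kubota1965, §4 Lemma 2]
[cite: Hazama2003CyclicCM, Thm. 4.8] [cite: Washington1997, Ch. 2 Thm. 2.5] -/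
theorem hodgeConjectureFor_pow_of_forall_intermediateField_seventyThree [IsCyclotomicExtension {73} ℚ L] [IsCMField L] [IsAbelianGalois ℚ L]
    (hW : ∀ F : IntermediateField ℚ L, Module.finrank ℚ F = 2 → ¬ IsTotallyReal F →
        ¬ ∀ τ : F →+* ℂ, {φ : L →+* ℂ | φ.comp (algebraMap F L) = τ ∧ φ ∈ Φ.1}.ncard =
          {φ : L →+* ℂ | φ.comp (algebraMap F L) = τ ∧ φ ∉ Φ.1}.ncard)
    (hP : ∀ j ∈ Finset.Icc 2 (2 + 1), ∀ F : IntermediateField ℚ L, Module.finrank ℚ F = 2 ^ j → ¬ IsTotallyReal F → IsCyclic (F ≃ₐ[ℚ] F) →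
        ¬ ∀ τ : F →+* ℂ, 2 * {φ : L →+* ℂ | φ.comp (algebraMap F L) = τ ∧ φ ∈ Φ.1}.ncard = Module.finrank F L)
    (hD : ∀ j ∈ Finset.Icc 1 (2 + 1), ∀ d : ℕ, d ∣ 9 → d ≠ 1 → ∀ F : IntermediateField ℚ L, Module.finrank ℚ F = 2 ^ j * d → ¬ IsTotallyReal F →
        IsCyclic (F ≃ₐ[ℚ] F) → ∀ [IsAbelianGalois ℚ F],
        ¬ ∀ σ : ↥d.primeFactors → (F ≃ₐ[ℚ] F), (∀ q, σ q ^ (q : ℕ) = 1) → ∀ τ : F →+* ℂ,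
          ∑ ε : ↥d.primeFactors → Bool, (∏ q, (if ε q then (-1 : ℤ) else 1)) *
            ({φ : L →+* ℂ | φ.comp (algebraMap F L) = τ.comp (∏ q, (if ε q then σ q else 1)).toRingEquiv.toRingHom ∧
              φ ∈ Φ.1}.ncard : ℤ) = 0)
    (hA : IsCMTypeRealisation Φ A ι θ) (n : ℕ) :
    HodgeConjectureFor (⨁ fun _ : Fin n => A).dim (⨁ fun _ : Fin n => A).X :=
  haveI : NeZero (73 : ℕ) := ⟨by norm_num⟩
  hodgeConjectureFor_pow_of_forall_intermediateField_of_isCyclotomicExtension (N := 73) (m := 9) (r := 2) (by norm_num) (by norm_num)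
    units_pow_seventyTwo_seventyThree hW hP hD hA n

/-- **`ℚ(ζ₁₁₉)`** (CM `48`-folds; `119 = 7·17`, `Gal ≅ ℤ/6 × ℤ/16` — NOT cyclic — of exponent `48 = 2⁴·3`, `φ(119) = 96`: lists `b`, `e₄, e₈, e₁₆`, `s_{2^j·3}`, `j ≤ 4`):
the Hodge conjecture for all powers of every abelian variety of a type off the subfield lists — UNCONDITIONAL. [cite: Gordon1999HodgeAVSurvey, Thm. 6.4 and §9.3]
[cite: Kubota1965, §4 Lemma 2] [cite: Washington1997, Ch. 2 Thm. 2.5] -/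
theorem hodgeConjectureFor_pow_of_forall_intermediateField_oneHundredNineteen [IsCyclotomicExtension {119} ℚ L] [IsCMField L] [IsAbelianGalois ℚ L]
    (hW : ∀ F : IntermediateField ℚ L, Module.finrank ℚ F = 2 → ¬ IsTotallyReal F →
        ¬ ∀ τ : F →+* ℂ, {φ : L →+* ℂ | φ.comp (algebraMap F L) = τ ∧ φ ∈ Φ.1}.ncard =
          {φ : L →+* ℂ | φ.comp (algebraMap F L) = τ ∧ φ ∉ Φ.1}.ncard)
    (hP : ∀ j ∈ Finset.Icc 2 (3 + 1), ∀ F : IntermediateField ℚ L, Module.finrank ℚ F = 2 ^ j → ¬ IsTotallyReal F → IsCyclic (F ≃ₐ[ℚ] F) →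
        ¬ ∀ τ : F →+* ℂ, 2 * {φ : L →+* ℂ | φ.comp (algebraMap F L) = τ ∧ φ ∈ Φ.1}.ncard = Module.finrank F L)
    (hD : ∀ j ∈ Finset.Icc 1 (3 + 1), ∀ d : ℕ, d ∣ 3 → d ≠ 1 → ∀ F : IntermediateField ℚ L, Module.finrank ℚ F = 2 ^ j * d → ¬ IsTotallyReal F →
        IsCyclic (F ≃ₐ[ℚ] F) → ∀ [IsAbelianGalois ℚ F],
        ¬ ∀ σ : ↥d.primeFactors → (F ≃ₐ[ℚ] F), (∀ q, σ q ^ (q : ℕ) = 1) → ∀ τ : F →+* ℂ,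
          ∑ ε : ↥d.primeFactors → Bool, (∏ q, (if ε q then (-1 : ℤ) else 1)) *
            ({φ : L →+* ℂ | φ.comp (algebraMap F L) = τ.comp (∏ q, (if ε q then σ q else 1)).toRingEquiv.toRingHom ∧
              φ ∈ Φ.1}.ncard : ℤ) = 0)
    (hA : IsCMTypeRealisation Φ A ι θ) (n : ℕ) :
    HodgeConjectureFor (⨁ fun _ : Fin n => A).dim (⨁ fun _ : Fin n => A).X :=
  haveI : NeZero (119 : ℕ) := ⟨by norm_num⟩
  hodgeConjectureFor_pow_of_forall_intermediateField_of_isCyclotomicExtension (N := 119) (m := 3) (r := 3) (by norm_num) (by norm_num)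
    units_pow_fortyEight_oneHundredNineteen hW hP hD hA n

end Cyclotomic

end RankFormula

end Literature.AlgebraicGeometry.Pohlmann1968
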